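import Summits.BirchSwinnertonDyer.BirchSwinnertonDyer.Theorems.ClassRecordThreeEulerHalvesAtThreeCartanSupplyCubicPointsFixedRoots
import HarnessLib

/-!
# Fixed points on the cubic points, IV: the count by matrix type, `E(g) = (q−1)/3 · F(g)`

Helper file `--supports stmt-BirchSwinnertonDyer-23422` (seat `bsd-stepL-tam3-p1` g23, LINE OWNER of crux 23422 `EulerHalvesAtThreeResidualUpperBound`,
line `cartan` v11), serving the registered stub (SUPPLY) `stub_cartanTorusLatticeSupply` via `HOME/tam3-p1/g23/SUPPLY-ROAD-GG1.md` §1–§2.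
With `E(g) = #{v ≠ 0 : g v = a v, ∃ u, u³ det g = a²}` (the numerator of the number of `g`-fixed CUBIC POINTS, Parts I–III) and
`E₀(g) = #{v ≠ 0 : g v = a v}` (the numerator of `#Fix(g | ℙ¹)`), for `q ≡ 1 (mod 3)`:
* `card_eigvec0_of_isScalar ∕ _of_not_isScalar` : `E₀(g) = q² − 1`, resp. `(q − 1)·rootCount`;
* `exists_eigvec`, `eq_smul_of_collinear`, `isScalarMat_pow_iff_of_split` : for `g` with rational eigenvalues `λ ≠ μ`,
  `IsScalarMat (g^k) ↔ λ^k = μ^k ↔ ∃ u, u³ μ = λ` (`k = (q−1)/3`; two independent eigenvectors);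
* **`card_eigvecCube_eq_fixedType`** : `E(g) = (q−1)/3 · F(g)` with
  `F(g) = [scalar] 3(q+1) | [Δ = 0] 3 | [split] (6 if IsScalarMat (g^k) else 0) | [elliptic] 0` (an explicit `if` cascade), and
  **`fixedType_sub_fixedP1Type`** : `F(g) − F_{ℙ¹}(g) = 2·χ_W(g)` where `F_{ℙ¹}(g) = [scalar] q+1 | [Δ=0] 1 | [split] 2 | 0` is the fixed-point count on `ℙ¹`
  (`…FixedPointsP1.natCard_fixed_P1`) and `χ_W = cubicNewvectorCharMat q g` BY NAME — the numerical heart of `π_C − π_{ℙ¹} = 2χ_W`.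
HONEST FRAMING: finite-field counting; nothing about SUPPLY, NUM, crux 23422 ∕ 19109 is proved here; BSD is proved for no curve. [folklore]
-/

namespace Summit.BirchSwinnertonDyer.BirchSwinnertonDyer.Theorems.CartanSupply.CubicPointsFixed

open Summit.BirchSwinnertonDyer.BirchSwinnertonDyer.Theorems.CartanDegree
open Summit.BirchSwinnertonDyer.BirchSwinnertonDyer.Theorems.CartanTorusCubeCut
open Summit.BirchSwinnertonDyer.BirchSwinnertonDyer.Theorems.CartanSupply.KernelCounts

set_option linter.dupNamespace false
set_option autoImplicit false

open scoped Classical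

variable {q : ℕ} [Fact q.Prime]

/-! ## §1 The plain eigenvector count `E₀(g)` -/

/-- PROVED: `E₀(g) = q² − 1` for scalar `g`. [folklore] -/
theorem card_eigvec0_of_isScalar (M : Mat q) (hs : IsScalarMat M) :
    (Finset.univ.filter fun v : Fin 2 → ZMod q => v ≠ 0 ∧ ∃ a : ZMod q, M.mulVec v = a • v).card = q ^ 2 - 1 := by
  obtain ⟨c, hc⟩ := (PS.isScalarMat_iff_eq_smul_one M).mp hs
  have hall : (Finset.univ.filter fun v : Fin 2 → ZMod q => v ≠ 0 ∧ ∃ a : ZMod q, M.mulVec v = a • v) =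
      Finset.univ.filter fun v : Fin 2 → ZMod q => v ≠ 0 := by
    apply Finset.filter_congr
    intro v _
    constructor
    · exact fun h => h.1
    · intro hv
      refine ⟨hv, c, ?_⟩
      rw [hc, Matrix.smul_mulVec, Matrix.one_mulVec]
  rw [hall, Finset.filter_ne' Finset.univ (0 : Fin 2 → ZMod q), Finset.card_erase_of_mem (Finset.mem_univ _), Finset.card_univ,
    Fintype.card_fun, ZMod.card, Fintype.card_fin]

/-- PROVED: `E₀(g) = (q − 1)·#{a : a² + det = tr·a}` for non-scalar `g`. [folklore] -/
theorem card_eigvec0_of_not_isScalar (M : Mat q) (hs : ¬ IsScalarMat M) :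
    (Finset.univ.filter fun v : Fin 2 → ZMod q => v ≠ 0 ∧ ∃ a : ZMod q, M.mulVec v = a • v).card =
      (q - 1) * (Finset.univ.filter fun a : ZMod q => a * a + M.det = M.trace * a).card := by
  have h0 := card_eigvec_eq_sum M (fun _ => True)
  beta_reduce at h0
  have hT : (Finset.univ.filter fun _ : ZMod q => True) = Finset.univ := Finset.filter_true_of_mem fun _ _ => trivial
  have hL : (Finset.univ.filter fun v : Fin 2 → ZMod q => v ≠ 0 ∧ ∃ a : ZMod q, M.mulVec v = a • v) =
      Finset.univ.filter fun v : Fin 2 → ZMod q => v ≠ 0 ∧ ∃ a : ZMod q, M.mulVec v = a • v ∧ True := by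
    apply Finset.filter_congr
    intro v _
    simp only [and_true]
  have h0' : (Finset.univ.filter fun v : Fin 2 → ZMod q => v ≠ 0 ∧ ∃ a : ZMod q, M.mulVec v = a • v).card =
      ∑ a ∈ (Finset.univ : Finset (ZMod q)), ((Finset.univ.filter fun v : Fin 2 → ZMod q => (M - a • (1 : Mat q)).mulVec v = 0).card - 1) := by
    rw [hL]
    convert h0 using 2
    · first
        | exact Finset.filter_congr_decidable _ _ _
        | exact (Finset.filter_congr_decidable _ _ _).symm
    · ext a
      simp
  rw [h0']
  simp_rw [card_ker_sub_smul_of_not_isScalar M hs]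
  rw [Finset.card_eq_sum_ones, Finset.mul_sum, mul_one,
    ← Finset.sum_filter_add_sum_filter_not Finset.univ (fun a : ZMod q => a * a + M.det = M.trace * a)]
  have h1 : ∑ a ∈ Finset.univ.filter (fun a : ZMod q => a * a + M.det = M.trace * a),
      ((if a * a + M.det = M.trace * a then q else 1) - 1) =
      ∑ a ∈ Finset.univ.filter (fun a : ZMod q => a * a + M.det = M.trace * a), (q - 1) := by
    apply Finset.sum_congr rfl
    intro a ha
    rw [Finset.mem_filter] at ha
    rw [if_pos ha.2]
  have h2 : ∑ a ∈ Finset.univ.filter (fun a : ZMod q => ¬ (a * a + M.det = M.trace * a)),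
      ((if a * a + M.det = M.trace * a then q else 1) - 1) = 0 := by
    apply Finset.sum_eq_zero
    intro a ha
    rw [Finset.mem_filter] at ha
    rw [if_neg ha.2]
    rfl
  rw [h1, h2, add_zero, Finset.sum_const, smul_eq_mul, mul_comm]

/-! ## §2 Split elements: `IsScalarMat (g^k) ↔ λ^k = μ^k ↔ λ/μ` is a cube -/

/-- PROVED: a rational eigenvalue of a non-scalar matrix has a non-zero eigenvector. [folklore] -/
theorem exists_eigvec (M : Mat q) (hs : ¬ IsScalarMat M) {l : ZMod q} (hl : l * l + M.det = M.trace * l) :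
    ∃ v : Fin 2 → ZMod q, v ≠ 0 ∧ M.mulVec v = l • v := by
  have hcard := card_ker_sub_smul_of_not_isScalar M hs l
  rw [if_pos hl] at hcard
  have h2 : 1 < (Finset.univ.filter fun v : Fin 2 → ZMod q => (M - l • (1 : Mat q)).mulVec v = 0).card := by
    rw [hcard]; exact (Fact.out : q.Prime).one_lt
  obtain ⟨v, hv, w, hw, hvw⟩ := Finset.one_lt_card.mp h2
  simp only [Finset.mem_filter, Finset.mem_univ, true_and] at hv hw
  by_cases hv0 : v = 0
  · refine ⟨w, fun hw0 => hvw (by rw [hv0, hw0]), ?_⟩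
    rwa [mulVec_eq_smul_iff]
  · exact ⟨v, hv0, by rwa [mulVec_eq_smul_iff]⟩

/-- PROVED: two collinear vectors, the first non-zero: the second is a multiple of the first. [folklore] -/
theorem eq_smul_of_collinear {v w : Fin 2 → ZMod q} (hv : v ≠ 0) (h : v 0 * w 1 = v 1 * w 0) : ∃ c : ZMod q, w = c • v := by
  by_cases hv0 : v 0 = 0
  · have hv1 : v 1 ≠ 0 := by
      intro hv1; apply hv; ext i; fin_cases i <;> simp [hv0, hv1]
    have hw0 : w 0 = 0 := by
      rw [hv0, zero_mul] at h
      rcases mul_eq_zero.mp h.symm with h' | h'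
      · exact absurd h' hv1
      · exact h'
    refine ⟨w 1 * (v 1)⁻¹, ?_⟩
    ext i; fin_cases i
    · simp [hv0, hw0]
    · simp; field_simp
  · refine ⟨w 0 * (v 0)⁻¹, ?_⟩
    ext i; fin_cases i
    · simp; field_simp
    · simp; field_simp; linear_combination h

/-- PROVED: `M v = l v ⇒ M^k v = l^k v`. [folklore] -/
theorem pow_mulVec_of_eigvec (M : Mat q) {v : Fin 2 → ZMod q} {l : ZMod q} (h : M.mulVec v = l • v) (k : ℕ) :
    (M ^ k).mulVec v = l ^ k • v := by
  induction k with
  | zero => simp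
  | succ k ih => rw [pow_succ, ← Matrix.mulVec_mulVec, h, Matrix.mulVec_smul, ih, smul_smul, pow_succ, mul_comm]

/-- PROVED: a matrix acting by the same scalar `c` on two independent vectors is `c·1`. [folklore] -/
theorem eq_smul_one_of_two_eigvec (N : Mat q) {v w : Fin 2 → ZMod q} (c : ZMod q) (hv : N.mulVec v = c • v) (hw : N.mulVec w = c • w)
    (hind : v 0 * w 1 - v 1 * w 0 ≠ 0) : N = c • (1 : Mat q) := by
  -- `N P = c P` with `P = (v | w)` invertible
  let P : Mat q := Matrix.of fun i j : Fin 2 => if j = 0 then v i else w i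
  have hP : P.det = v 0 * w 1 - v 1 * w 0 := CubicPointsFixed.det_of_cols v w
  have hNP : N * P = c • P := by
    ext i j
    fin_cases j
    · have := congrFun hv i
      simp only [Matrix.mulVec, dotProduct, Fin.sum_univ_two, Pi.smul_apply, smul_eq_mul] at this
      simp [Matrix.mul_apply, Fin.sum_univ_two, P, this]
    · have := congrFun hw i
      simp only [Matrix.mulVec, dotProduct, Fin.sum_univ_two, Pi.smul_apply, smul_eq_mul] at this
      simp [Matrix.mul_apply, Fin.sum_univ_two, P, this]
  have hPu : IsUnit P.det := by rw [hP]; exact isUnit_iff_ne_zero.mpr hind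
  calc N = N * P * P⁻¹ := by rw [Matrix.mul_nonsing_inv_cancel_right _ _ hPu]
    _ = c • (1 : Mat q) := by rw [hNP, Matrix.smul_mul, Matrix.mul_nonsing_inv _ hPu]

/-- PROVED — **SPLIT ELEMENTS**: for non-scalar `M` with rational eigenvalues `l ≠ m`, `IsScalarMat (M^k) ↔ l^k = m^k`. [folklore] -/
theorem isScalarMat_pow_iff_of_split (M : Mat q) (hs : ¬ IsScalarMat M) {l m : ZMod q} (hlm : l ≠ m) (hsum : l + m = M.trace)
    (hprod : l * m = M.det) (k : ℕ) : IsScalarMat (M ^ k) ↔ l ^ k = m ^ k := by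
  have hl : l * l + M.det = M.trace * l := by rw [← hsum, ← hprod]; ring
  have hm : m * m + M.det = M.trace * m := by rw [← hsum, ← hprod]; ring
  obtain ⟨v, hv0, hv⟩ := exists_eigvec M hs hl
  obtain ⟨w, hw0, hw⟩ := exists_eigvec M hs hm
  have hind : v 0 * w 1 - v 1 * w 0 ≠ 0 := by
    intro h
    obtain ⟨c, hc⟩ := eq_smul_of_collinear hv0 (sub_eq_zero.mp h)
    have hw' : M.mulVec w = l • w := by rw [hc, Matrix.mulVec_smul, hv, smul_comm]
    exact hlm (eigenvalue_unique hw0 hw' hw)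
  have hvk := pow_mulVec_of_eigvec M hv k
  have hwk := pow_mulVec_of_eigvec M hw k
  rw [PS.isScalarMat_iff_eq_smul_one]
  constructor
  · rintro ⟨c, hc⟩
    have h1 : (M ^ k).mulVec v = c • v := by rw [hc, Matrix.smul_mulVec, Matrix.one_mulVec]
    have h2 : (M ^ k).mulVec w = c • w := by rw [hc, Matrix.smul_mulVec, Matrix.one_mulVec]
    rw [eigenvalue_unique hv0 hvk h1, eigenvalue_unique hw0 hwk h2]
  · intro hk
    refine ⟨l ^ k, eq_smul_one_of_two_eigvec _ _ hvk ?_ hind⟩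
    rw [hk]; exact hwk

/-- PROVED (`q ≡ 1 (3)`, `k = (q−1)/3`): for units `l, m`, `l^k = m^k ↔ ∃ u, u³ m = l`. [folklore] -/
theorem pow_eq_pow_iff_cube_ratio (h1 : q % 3 = 1) {l m : ZMod q} (hl0 : l ≠ 0) (hm0 : m ≠ 0) :
    l ^ ((q - 1) / 3) = m ^ ((q - 1) / 3) ↔ ∃ u : ZMod q, u ^ 3 * m = l := by
  have hlm0 : l * m⁻¹ ≠ 0 := mul_ne_zero hl0 (inv_ne_zero hm0)
  have key := cube_iff_pow h1 hlm0
  have hmk : m ^ ((q - 1) / 3) ≠ 0 := pow_ne_zero _ hm0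
  constructor
  · intro h
    have h' : (l * m⁻¹) ^ ((q - 1) / 3) = 1 := by
      rw [mul_pow, h, inv_pow, mul_inv_cancel₀ hmk]
    obtain ⟨u, hu⟩ := key.mpr h'
    exact ⟨u, by rw [hu]; field_simp⟩
  · rintro ⟨u, hu⟩
    have h' : (l * m⁻¹) ^ ((q - 1) / 3) = 1 := key.mp ⟨u, by rw [← hu]; field_simp⟩
    rw [mul_pow, inv_pow] at h'
    have := congrArg (· * m ^ ((q - 1) / 3)) h'
    simpa [mul_assoc, inv_mul_cancel₀ hmk] using this

/-! ## §3 The count by type -/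

/-- PROVED — **THE CUBIC FIXED-POINT NUMERATOR BY TYPE** (`q ≡ 1 (mod 3)`): `E(g) = (q−1)/3 · F(g)`. [folklore] -/
theorem card_eigvecCube_eq_fixedType (h1 : q % 3 = 1) (g : G q) :
    (Finset.univ.filter fun v : Fin 2 → ZMod q => v ≠ 0 ∧
        ∃ a : ZMod q, (g : Mat q).mulVec v = a • v ∧ ∃ u : ZMod q, u ^ 3 * (g : Mat q).det = a ^ 2).card =
      (q - 1) / 3 * (if IsScalarMat (g : Mat q) then 3 * (q + 1)
        else if (g : Mat q).trace ^ 2 - 4 * (g : Mat q).det = 0 then 3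
        else if HasRatEigenvalue (g : Mat q) then (if IsScalarMat ((g : Mat q) ^ ((q - 1) / 3)) then 6 else 0) else 0) := by
  have hk := PS.three_mul_k h1
  have h2 : (2 : ZMod q) ≠ 0 := by
    have hq2 : q ≠ 2 := by rintro rfl; simp at h1
    intro h
    have h' : ((2 : ℕ) : ZMod q) = 0 := by exact_mod_cast h
    rw [ZMod.natCast_eq_zero_iff] at h'
    exact hq2 ((Nat.prime_dvd_prime_iff_eq (Fact.out : q.Prime) Nat.prime_two).1 h')
  by_cases hs : IsScalarMat (g : Mat q)
  · rw [card_eigvec_of_isScalar g hs, if_pos hs, ← mul_assoc, Nat.div_mul_cancel (by omega : 3 ∣ q - 1)]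
    have hq : 1 ≤ q := (Fact.out : q.Prime).one_lt.le
    zify [hq, Nat.one_le_pow 2 q hq]
    ring
  rw [card_eigvec_of_not_isScalar g hs, if_neg hs]
  by_cases hΔ : (g : Mat q).trace ^ 2 - 4 * (g : Mat q).det = 0
  · rw [if_pos hΔ, rootsCube_card_of_discr_eq_zero h2 _ hΔ]; omega
  rw [if_neg hΔ]
  by_cases hrat : HasRatEigenvalue (g : Mat q)
  · rw [if_pos hrat]
    obtain ⟨l, hl⟩ := hrat
    set m : ZMod q := (g : Mat q).trace - l with hm
    have hsum : l + m = (g : Mat q).trace := by rw [hm]; ring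
    have hprod : l * m = (g : Mat q).det := by rw [hm]; linear_combination -hl
    have hlm : l ≠ m := by
      intro h
      apply hΔ
      rw [← hsum, ← hprod, ← h]; ring
    have hdet : (g : Mat q).det ≠ 0 := by
      have := g.isUnit
      rw [Matrix.isUnit_iff_isUnit_det, isUnit_iff_ne_zero] at this
      exact this
    have hl0 : l ≠ 0 := fun h => hdet (by rw [← hprod, h, zero_mul])
    have hm0 : m ≠ 0 := fun h => hdet (by rw [← hprod, h, mul_zero])
    rw [rootsCube_card_of_split _ hlm hsum hprod hdet, isScalarMat_pow_iff_of_split _ hs hlm hsum hprod,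
      pow_eq_pow_iff_cube_ratio h1 hl0 hm0]
    by_cases hc : ∃ u : ZMod q, u ^ 3 * m = l
    · rw [if_pos hc, if_pos hc]; omega
    · rw [if_neg hc, if_neg hc]; simp
  · rw [if_neg hrat, rootsCube_card_of_not_hasRatEigenvalue _ hrat]; simp

/-- PROVED: `E₀(g) = (q − 1) · F_{ℙ¹}(g)` (`q ≡ 1 (3)`). [folklore] -/
theorem card_eigvec0_eq_fixedP1Type (h1 : q % 3 = 1) (g : G q) :
    (Finset.univ.filter fun v : Fin 2 → ZMod q => v ≠ 0 ∧ ∃ a : ZMod q, (g : Mat q).mulVec v = a • v).card =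
      (q - 1) * (if IsScalarMat (g : Mat q) then q + 1
        else if (g : Mat q).trace ^ 2 - 4 * (g : Mat q).det = 0 then 1
        else if HasRatEigenvalue (g : Mat q) then 2 else 0) := by
  have h2 : (2 : ZMod q) ≠ 0 := by
    have hq2 : q ≠ 2 := by rintro rfl; simp at h1
    intro h
    have h' : ((2 : ℕ) : ZMod q) = 0 := by exact_mod_cast h
    rw [ZMod.natCast_eq_zero_iff] at h'
    exact hq2 ((Nat.prime_dvd_prime_iff_eq (Fact.out : q.Prime) Nat.prime_two).1 h')
  by_cases hs : IsScalarMat (g : Mat q)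
  · rw [card_eigvec0_of_isScalar _ hs, if_pos hs]
    have hq : 1 ≤ q := (Fact.out : q.Prime).one_lt.le
    zify [hq, Nat.one_le_pow 2 q hq]
    ring
  rw [card_eigvec0_of_not_isScalar _ hs, if_neg hs]
  by_cases hΔ : (g : Mat q).trace ^ 2 - 4 * (g : Mat q).det = 0
  · rw [if_pos hΔ]
    have := rootCount_of_disc_eq_zero h2 hΔ
    rw [rootCount] at this
    rw [this]
  rw [if_neg hΔ]
  by_cases hrat : HasRatEigenvalue (g : Mat q)
  · rw [if_pos hrat]
    obtain ⟨l, hl⟩ := hrat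
    set m : ZMod q := (g : Mat q).trace - l with hm
    have hlm : l ≠ m := by
      intro h
      apply hΔ
      have : (g : Mat q).det = l * m := by rw [hm]; linear_combination hl
      rw [this, show (g : Mat q).trace = l + m by rw [hm]; ring, ← h]; ring
    have hroots : (Finset.univ.filter fun a : ZMod q => a * a + (g : Mat q).det = (g : Mat q).trace * a) = {l, m} := by
      ext a
      simp only [Finset.mem_filter, Finset.mem_univ, true_and, Finset.mem_insert, Finset.mem_singleton]
      constructor
      · intro ha
        have : (a - l) * (a - m) = 0 := by rw [hm]; linear_combination ha - hl
        rcases mul_eq_zero.mp this with h | h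
        · exact Or.inl (sub_eq_zero.mp h)
        · exact Or.inr (sub_eq_zero.mp h)
      · rintro (rfl | rfl)
        · exact hl
        · rw [hm]; linear_combination hl
    rw [hroots, Finset.card_pair hlm]
  · rw [if_neg hrat]
    have := rootCount_of_not_hasRatEigenvalue hrat
    rw [rootCount] at this
    rw [this, mul_zero]

/-- PROVED — **`F(g) − F_{ℙ¹}(g) = 2·χ_W(g)`** (`q ≡ 1 (mod 3)`), `χ_W = cubicNewvectorCharMat q` BY NAME, where `F`, `F_{ℙ¹}` are the two type
expressions of `card_eigvecCube_eq_fixedType`, `card_eigvec0_eq_fixedP1Type`. [folklore] -/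
theorem fixedType_sub_fixedP1Type (h1 : q % 3 = 1) (M : Mat q) :
    ((if IsScalarMat M then 3 * (q + 1)
        else if M.trace ^ 2 - 4 * M.det = 0 then 3
        else if HasRatEigenvalue M then (if IsScalarMat (M ^ ((q - 1) / 3)) then 6 else 0) else 0 : ℕ) : ℤ) -
      ((if IsScalarMat M then q + 1
        else if M.trace ^ 2 - 4 * M.det = 0 then 1
        else if HasRatEigenvalue M then 2 else 0 : ℕ) : ℤ) = 2 * cubicNewvectorCharMat q M := by
  unfold cubicNewvectorCharMat
  simp only [h1, if_true]
  by_cases hs : IsScalarMat M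
  · obtain ⟨c, hc⟩ := (PS.isScalarMat_iff_eq_smul_one M).mp hs
    have hΔ : M.trace ^ 2 - 4 * M.det = 0 := by
      rw [hc, Matrix.trace_smul, Matrix.det_smul, Matrix.trace_one, Matrix.det_one, Fintype.card_fin]
      simp; ring
    simp only [hs, if_true, hΔ]
    push_cast; ring
  · simp only [hs, if_false]
    by_cases hΔ : M.trace ^ 2 - 4 * M.det = 0
    · simp only [hΔ, if_true]; norm_num
    · simp only [hΔ, if_false]
      by_cases hrat : HasRatEigenvalue M
      · simp only [hrat, if_true]
        by_cases hk : IsScalarMat (M ^ ((q - 1) / 3))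
        · simp only [hk, if_true]; norm_num
        · simp only [hk, if_false]; norm_num
      · simp only [hrat, if_false]; norm_num

end Summit.BirchSwinnertonDyer.BirchSwinnertonDyer.Theorems.CartanSupply.CubicPointsFixed
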